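import Mathlib.MeasureTheory.Measure.Lebesgue.Integral
import HarnessLib
import Summits.RiemannHypothesis.RiemannHypothesis.Theorems.SignConePointwiseKernel
import Summits.RiemannHypothesis.RiemannHypothesis.Theorems.SignConePointwiseIdentity

/-!
# Route SignCone: the cosine transform of the kernel `E_χ` in closed form

Support for the unconditional rungs of `SignConeOscillatory` / `SignConeInequality`
(items stmt-RiemannHypothesis-16302 / 16301). For the kernel
`E_χ(x) = (e^{x/2} + e^{-x/2}) χ(|x|)` of `SignConePointwiseKernel.lean` (plateau `[0, L]`, knots
`x_k = L + k h`, interior values `χ_k`), the cosine transform of `SignConePointwiseIdentity.lean` is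

  `Ê_χ(y) = ∫ E_χ(x) cos(xy) dx
         = 4 [ (T(x_1,y) − T(x_0,y))/h + Σ_{k=1}^{K-1} χ_k (T(x_{k-1},y) − 2T(x_k,y) + T(x_{k+1},y))/h ]`,
  `T(x,y) = ((¼ − y²) cosh(x/2) cos(xy) + y sinh(x/2) sin(xy)) / (¼ + y²)²`

(`PWKernel.cosTransform_kernelE_eq`; all boundary `S`-terms telescope because `χ` is continuous and
`S(0,y) = 0`). Consequently `|Ê_χ(y)| ≤ 4 Σ_k |c_k| e^{x_k/2} / (¼ + y²)` with the second differences
`c_k` of `χ` (`PWKernel.abs_cosTransform_kernelE_le`), the decay used for the tail of the pointwise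
certificates, and `Ê_χ` is `‖x E_χ‖₁`-Lipschitz (`abs_cosTransform_sub_le`, from `|cos a − cos b| ≤ |a − b|`).
-/

noncomputable section

-- `Summit.RiemannHypothesis.RiemannHypothesis.…` repeats a namespace component by design (D-0017 layout).
set_option linter.dupNamespace false

open Real MeasureTheory Set intervalIntegral Filter

namespace Summit.RiemannHypothesis.RiemannHypothesis.Theorems.SignCone

/-! ## Pieces of the transform -/

/-- `e^{t/2} + e^{-t/2} = 2 cosh(t/2)`. [folklore] -/
theorem exp_half_add_exp_neg_half (t : ℝ) : Real.exp (t / 2) + Real.exp (-(t / 2)) = 2 * Real.cosh (t / 2) := by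
  rw [Real.cosh_eq]; ring

/-- `S(0, y) = 0`. [folklore] -/
theorem pwS_zero (y : ℝ) : pwS 0 y = 0 := by
  simp [pwS]

/-- A piece where the profile vanishes integrates to zero. [folklore] -/
theorem integral_piece_zero {g : ℝ → ℝ} {a b : ℝ} (hab : a ≤ b) (y : ℝ)
    (hg : ∀ t ∈ Icc a b, g t = 0) :
    ∫ t in a..b, (Real.exp (t / 2) + Real.exp (-(t / 2))) * g t * Real.cos (t * y) = 0 := by
  rw [← intervalIntegral.integral_zero (a := a) (b := b)]
  refine intervalIntegral.integral_congr fun t ht => ?_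
  rw [uIcc_of_le hab] at ht
  simp [hg t ht]

/-- A piece where the profile is affine: `∫_a^b (e^{t/2}+e^{-t/2})(α + βt) cos(ty) dt
= 2[(α+βt) S − β T]_a^b`. [folklore] -/
theorem integral_piece_affine {g : ℝ → ℝ} {a b : ℝ} (hab : a ≤ b) (y α β : ℝ)
    (hg : ∀ t ∈ Icc a b, g t = α + β * t) :
    ∫ t in a..b, (Real.exp (t / 2) + Real.exp (-(t / 2))) * g t * Real.cos (t * y) =
      2 * (((α + β * b) * pwS b y - β * pwT b y) - ((α + β * a) * pwS a y - β * pwT a y)) := by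
  rw [← integral_cosh_affine_cos α β y a b, ← intervalIntegral.integral_const_mul]
  refine intervalIntegral.integral_congr fun t ht => ?_
  rw [uIcc_of_le hab] at ht
  rw [hg t ht, exp_half_add_exp_neg_half]
  ring

/-- Interval integrability of the pieces (continuity). [folklore] -/
theorem intervalIntegrable_piece {g : ℝ → ℝ} (hg : Continuous g) (y a b : ℝ) :
    IntervalIntegrable (fun t => (Real.exp (t / 2) + Real.exp (-(t / 2))) * g t * Real.cos (t * y))
      volume a b :=
  (by fun_prop : Continuous fun t => (Real.exp (t / 2) + Real.exp (-(t / 2))) * g t * Real.cos (t * y))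
    |>.intervalIntegrable _ _

namespace PWKernel

variable {d : PWKernel} (hL : 0 ≤ d.L) (hh : 0 < d.h)
include hL hh

omit hL in
/-- Knots are ordered: `x_j ≤ x_k` for `j ≤ k`. [folklore] -/
theorem knot_mono {j k : ℕ} (hjk : j ≤ k) : (d.knot j : ℝ) ≤ d.knot k := by
  unfold knot; push_cast
  have : (j : ℝ) ≤ k := by exact_mod_cast hjk
  have hh' : (0 : ℝ) < d.h := by exact_mod_cast hh
  nlinarith

/-- `0 ≤ x_k`. [folklore] -/
theorem knot_nonneg (k : ℕ) : (0 : ℝ) ≤ d.knot k := by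
  have h0 : (d.knot 0 : ℝ) = d.L := by unfold knot; push_cast; ring
  have := knot_mono hh (Nat.zero_le k)
  rw [h0] at this
  have hL' : (0 : ℝ) ≤ d.L := by exact_mod_cast hL
  linarith

omit hL hh in
/-- `x_{k+1} = x_k + h`. [folklore] -/
theorem knot_succ (k : ℕ) : (d.knot (k + 1) : ℝ) = d.knot k + d.h := by
  unfold knot; push_cast; ring

/-- **The plateau piece**: `∫_0^{x_K} (e^{t/2}+e^{-t/2}) plateau(t) cos(ty) dt = 2 (T(x_1) − T(x_0))/h`. [folklore] -/
theorem integral_plateau_piece (y : ℝ) :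
    ∫ t in (0 : ℝ)..d.knot d.K, (Real.exp (t / 2) + Real.exp (-(t / 2))) * plateau d.L d.h t * Real.cos (t * y) =
      2 * ((pwT (d.knot 1) y - pwT (d.knot 0) y) / d.h) := by
  have hh' : (0 : ℝ) < d.h := by exact_mod_cast hh
  have hL' : (0 : ℝ) ≤ d.L := by exact_mod_cast hL
  have hK1 : 1 ≤ d.K := Nat.succ_le_of_lt (Nat.succ_pos _)
  have e0 : (d.knot 0 : ℝ) = d.L := by unfold knot; push_cast; ring
  have e1 : (d.knot 1 : ℝ) = d.L + d.h := by unfold knot; push_cast; ring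
  have hI := fun a b => intervalIntegrable_piece (continuous_plateau (d.L : ℝ) d.h) y a b
  rw [← integral_add_adjacent_intervals (hI 0 (d.L : ℝ)) (hI _ _),
    ← integral_add_adjacent_intervals (hI (d.L : ℝ) (d.L + d.h)) (hI _ _)]
  -- [0, L]: plateau = 1
  rw [integral_piece_affine hL' y 1 0 (fun t ht => by rw [plateau_of_le hh' ht.2]; ring)]
  -- [L, L+h]: plateau = (L+h-t)/h
  rw [integral_piece_affine (by linarith) y ((d.L + d.h) / d.h) (-(1 / d.h))
    (fun t ht => by rw [plateau_of_mem hh' ht.1 ht.2]; field_simp; ring)]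
  -- [L+h, x_K]: plateau = 0
  have hX : (d.L : ℝ) + d.h ≤ d.knot d.K := by rw [← e1]; exact knot_mono hh hK1
  rw [integral_piece_zero hX y (fun t ht => plateau_of_ge hh' ht.1)]
  rw [e0, e1, pwS_zero]
  field_simp
  ring

/-- **A hat piece** (`1 ≤ k`, `k + 1 ≤ K`):
`∫_0^{x_K} (e^{t/2}+e^{-t/2}) hat_k(t) cos(ty) dt = 2 (T(x_{k-1}) − 2T(x_k) + T(x_{k+1}))/h`. [folklore] -/
theorem integral_hat_piece (y : ℝ) {k : ℕ} (hk1 : 1 ≤ k) (hkK : k + 1 ≤ d.K) :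
    ∫ t in (0 : ℝ)..d.knot d.K,
        (Real.exp (t / 2) + Real.exp (-(t / 2))) * hat (d.knot k) d.h t * Real.cos (t * y) =
      2 * ((pwT (d.knot (k - 1)) y - 2 * pwT (d.knot k) y + pwT (d.knot (k + 1)) y) / d.h) := by
  have hh' : (0 : ℝ) < d.h := by exact_mod_cast hh
  obtain ⟨j, rfl⟩ : ∃ j, k = j + 1 := ⟨k - 1, by omega⟩
  simp only [Nat.add_sub_cancel]
  have ej1 : (d.knot (j + 1) : ℝ) = d.knot j + d.h := knot_succ j
  have ej2 : (d.knot (j + 1 + 1) : ℝ) = d.knot j + d.h + d.h := by rw [knot_succ, ej1]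
  have h0j : (0 : ℝ) ≤ d.knot j := knot_nonneg hL hh j
  have hjK : (d.knot j : ℝ) + d.h + d.h ≤ d.knot d.K := by rw [← ej2]; exact knot_mono hh hkK
  rw [ej2, ej1]
  set c : ℝ := (d.knot j : ℝ) + d.h with hc
  have hI := fun a b => intervalIntegrable_piece (continuous_hat c d.h) y a b
  rw [← integral_add_adjacent_intervals (hI 0 (d.knot j : ℝ)) (hI _ _),
    ← integral_add_adjacent_intervals (hI (d.knot j : ℝ) c) (hI _ _),
    ← integral_add_adjacent_intervals (hI c (c + d.h)) (hI _ _)]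
  -- [0, x_j]: hat = 0
  rw [integral_piece_zero h0j y (fun t ht => hat_of_le_abs hh' (by
      rw [abs_of_nonpos (by rw [hc]; linarith [ht.2])]; rw [hc]; linarith [ht.2]))]
  -- [x_j, c]: hat = (t - x_j)/h
  rw [integral_piece_affine (by rw [hc]; linarith) y (-(d.knot j : ℝ) / d.h) (1 / d.h)
    (fun t ht => by
      rw [hat_of_mem_left hh' (by rw [hc]; linarith [ht.1]) ht.2, hc]
      field_simp; ring)]
  -- [c, c + h]: hat = (c + h - t)/h
  rw [integral_piece_affine (by linarith) y ((c + d.h) / d.h) (-(1 / d.h))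
    (fun t ht => by
      rw [hat_of_mem_right hh' ht.1 ht.2]
      field_simp; ring)]
  -- [c + h, x_K]: hat = 0
  rw [integral_piece_zero hjK y (fun t ht => hat_of_le_abs hh' (by
      rw [abs_of_nonneg (by rw [hc] at ht ⊢; linarith [ht.1])]; rw [hc] at ht ⊢; linarith [ht.1]))]
  rw [hc]
  field_simp
  ring

/-- The closed form of `Ê_χ`:
`4 [ (T(x_1) − T(x_0))/h + Σ_{k=1}^{K-1} χ_k (T(x_{k-1}) − 2T(x_k) + T(x_{k+1}))/h ]`. [folklore] -/
def ehatCF (d : PWKernel) (y : ℝ) : ℝ :=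
  4 * ((pwT (d.knot 1) y - pwT (d.knot 0) y) / d.h +
    ∑ k ∈ Finset.Ico 1 d.K, (d.chiAt k : ℝ) *
      ((pwT (d.knot (k - 1)) y - 2 * pwT (d.knot k) y + pwT (d.knot (k + 1)) y) / d.h))

/-- **The cosine transform of `E_χ` in closed form.** `Ê_χ(y) = ehatCF d y`. [folklore] -/
theorem cosTransform_kernelE_eq (y : ℝ) : cosTransform d.kernelE y = d.ehatCF y := by
  have hh' : (0 : ℝ) < d.h := by exact_mod_cast hh
  -- integrand as a function of |x|
  set f : ℝ → ℝ := fun t => (Real.exp (t / 2) + Real.exp (-(t / 2))) * d.chiR t * Real.cos (t * y) with hf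
  have hfx : ∀ x : ℝ, d.kernelE x * Real.cos (x * y) = f |x| := by
    intro x
    rw [hf]
    unfold kernelE
    simp only
    rcases le_or_gt 0 x with h0 | h0
    · rw [abs_of_nonneg h0]
    · rw [abs_of_neg h0, show -x * y = -(x * y) by ring, Real.cos_neg]
  unfold cosTransform
  simp_rw [hfx]
  rw [integral_comp_abs (f := f)]
  -- restrict to [0, x_K]
  have hX0 : (0 : ℝ) ≤ d.knot d.K := knot_nonneg hL hh _
  have hzero : ∀ t, (d.knot d.K : ℝ) ≤ t → f t = 0 := fun t ht => by
    rw [hf]; simp only; rw [chiR_eq_zero_of_ge hh ht]; ring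
  have hrestr : ∫ t in Ioi (0 : ℝ), f t = ∫ t in (0 : ℝ)..d.knot d.K, f t := by
    rw [intervalIntegral.integral_of_le hX0]
    refine setIntegral_eq_of_subset_of_forall_sdiff_eq_zero measurableSet_Ioi Ioc_subset_Ioi_self
      fun t ht => hzero t ?_
    rw [Set.mem_sdiff, mem_Ioi, mem_Ioc] at ht
    by_contra hlt
    exact ht.2 ⟨ht.1, (not_le.1 hlt).le⟩
  rw [hrestr]
  -- expand χ and integrate termwise
  have hsplit : ∀ t, f t =
      (Real.exp (t / 2) + Real.exp (-(t / 2))) * plateau d.L d.h t * Real.cos (t * y) +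
        ∑ k ∈ Finset.Ico 1 d.K, (d.chiAt k : ℝ) *
          ((Real.exp (t / 2) + Real.exp (-(t / 2))) * hat (d.knot k) d.h t * Real.cos (t * y)) := by
    intro t
    rw [hf]
    unfold chiR
    simp only
    rw [mul_add, add_mul, Finset.mul_sum, Finset.sum_mul]
    congr 1
    refine Finset.sum_congr rfl fun k _ => ?_
    ring
  simp_rw [hsplit]
  have hIp := intervalIntegrable_piece (continuous_plateau (d.L : ℝ) d.h) y 0 (d.knot d.K)
  have hIk : ∀ k ∈ Finset.Ico 1 d.K, IntervalIntegrable (fun t => (d.chiAt k : ℝ) *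
      ((Real.exp (t / 2) + Real.exp (-(t / 2))) * hat (d.knot k) d.h t * Real.cos (t * y)))
      volume 0 (d.knot d.K) :=
    fun k _ => (intervalIntegrable_piece (continuous_hat (d.knot k : ℝ) d.h) y _ _).const_mul _
  have hIs : IntervalIntegrable (fun t => ∑ k ∈ Finset.Ico 1 d.K, (d.chiAt k : ℝ) *
      ((Real.exp (t / 2) + Real.exp (-(t / 2))) * hat (d.knot k) d.h t * Real.cos (t * y)))
      volume 0 (d.knot d.K) :=
    (continuous_finsetSum _ fun k _ => continuous_const.mul
      ((by fun_prop : Continuous fun t => Real.exp (t / 2) + Real.exp (-(t / 2))).mul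
        (continuous_hat _ _) |>.mul (by fun_prop))).intervalIntegrable _ _
  rw [intervalIntegral.integral_add hIp hIs, intervalIntegral.integral_finsetSum hIk,
    integral_plateau_piece hL hh y]
  have hsum : ∑ k ∈ Finset.Ico 1 d.K, ∫ t in (0 : ℝ)..d.knot d.K, (d.chiAt k : ℝ) *
      ((Real.exp (t / 2) + Real.exp (-(t / 2))) * hat (d.knot k) d.h t * Real.cos (t * y)) =
      ∑ k ∈ Finset.Ico 1 d.K, (d.chiAt k : ℝ) *
        (2 * ((pwT (d.knot (k - 1)) y - 2 * pwT (d.knot k) y + pwT (d.knot (k + 1)) y) / d.h)) := by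
    refine Finset.sum_congr rfl fun k hk => ?_
    rw [Finset.mem_Ico] at hk
    rw [intervalIntegral.integral_const_mul, integral_hat_piece hL hh y hk.1 (by omega)]
  rw [hsum]
  unfold ehatCF
  rw [mul_add, mul_add, Finset.mul_sum, Finset.mul_sum]
  congr 1
  · ring
  · exact Finset.sum_congr rfl fun k _ => by ring

end PWKernel

/-! ## Lipschitz bound for cosine transforms -/

/-- **`Ê` is `‖x E‖₁`-Lipschitz**: `|Ê(y₁) − Ê(y₂)| ≤ (∫ |x| |E(x)| dx) · |y₁ − y₂|` for a continuous
compactly supported kernel (`|cos a − cos b| ≤ |a − b|`). [folklore] -/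
theorem abs_cosTransform_sub_le {E : ℝ → ℝ} (hEc : Continuous E) (hEs : HasCompactSupport E)
    (y₁ y₂ : ℝ) :
    |cosTransform E y₁ - cosTransform E y₂| ≤ (∫ x : ℝ, |x| * |E x|) * |y₁ - y₂| := by
  unfold cosTransform
  have i1 := integrable_kernel_mul_cos hEc hEs y₁
  have i2 := integrable_kernel_mul_cos hEc hEs y₂
  have iB : Integrable fun x : ℝ => |x| * |E x| :=
    ((continuous_abs.mul (continuous_abs.comp hEc)).integrable_of_hasCompactSupport
      ((hEs.norm).mul_left))
  rw [← integral_sub i1 i2, ← MeasureTheory.integral_mul_const]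
  refine (MeasureTheory.abs_integral_le_integral_abs
    (f := fun x => E x * Real.cos (x * y₁) - E x * Real.cos (x * y₂))).trans ?_
  refine integral_mono_of_nonneg (Eventually.of_forall fun x => abs_nonneg _) (iB.mul_const _)
    (Eventually.of_forall fun x => ?_)
  simp only
  rw [← mul_sub, abs_mul]
  have hc := Real.abs_cos_sub_cos_le (x * y₁) (x * y₂)
  rw [← mul_sub, abs_mul] at hc
  calc |E x| * |Real.cos (x * y₁) - Real.cos (x * y₂)| ≤ |E x| * (|x| * |y₁ - y₂|) :=
        mul_le_mul_of_nonneg_left hc (abs_nonneg _)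
    _ = |x| * |E x| * |y₁ - y₂| := by ring

end Summit.RiemannHypothesis.RiemannHypothesis.Theorems.SignCone

end
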